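import Summits.CriticalPhenomena.PercolationContinuityZ3.Theorems.PercNearOneGluingNoHeavyLowerTailKnQuestion8CoefficientwiseCoreClassKernelMixRegimeReduction
import HarnessLib

/-!
# The increasing-event transfer when the supply clusters cover everything (every graph, every up-set)

Support file (`--supports stmt-CriticalPhenomena-4575`, closed), prover `prim-cplus-coupling` (gen 41).  No definitions, no notations, no named facts,
no sorries; standard axioms.  Memo `prim-cplus-coupling/A5-COUPLING-gen41.md` §1.4.

CONJECTURE IET (gen 37 memo §2): `Σ_{ω ∈ 𝒱 : b ∈ X∖Y} h(X)k(X) + Σ_{ω ∈ 𝒱 : b ∈ Y∖X} (hᵃX − hᵇY)(kᵃX − kᵇY) ≥ 0`, `X = C_u ω`, `Y = C_u(E∖ω)`, for every up-closed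
`𝒱` and all admissible levels.  THE COVERED CASE: suppose every supply point's red cluster contains every cluster of every colouring,
`b ∈ X(ω')∖Y(ω') ⟹ X(ω) ∪ Y(ω) ⊆ X(ω')` for all `ω` (e.g. `X(ω') = V`: the bundles `Θ(2,…,2) = K_{2,r}` and `Θ(1,2,…,2)`, and every graph in which each
vertex other than `u, b` is adjacent to both `u` and `b` or separates them).  Then IET holds for every up-set: one two-colouring Harris inequality gives
`#(𝒱 ∩ {b ∈ Y∖X}) ≤ #(𝒱 ∩ {b ∈ X∖Y})` (the demand class is a down-set, its complement image is the supply class), every anti-term is `≥ −L` with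
`L = max(hᵃX, hᵇY)·max(kᵃX, kᵇY)` of the worst demand point, and every supply term is `≥ L` by the covering hypothesis and `hᵃ, hᵇ ≤ h`, `kᵃ, kᵇ ≤ k`.
* `Coefficientwise.card_demand_le_card_supply` — the count transfer (any graph, any up-set).
* `Coefficientwise.iet_of_supply_covers` — **IET under the covering hypothesis**.
[cite: KozmaNitzan2024, Questions 8–9 (§5.5 p. 36) (context: the Question-8 pocket covariance programme)]
-/

namespace Summit.CriticalPhenomena.PercolationContinuityZ3.Theorems

open Finset Literature.Probability.Percolation

namespace Coefficientwise

variable {ι V : Type*}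

open Classical in
/-- **Count transfer (every graph, every up-set).**  For an up-closed `𝒱` and any weight `L ≥ 0`:
`Σ_{ω ∈ 𝒱, b ∈ Y∖X} L ≤ Σ_{ω ∈ 𝒱, b ∈ X∖Y} L`, i.e. an up-set contains at least as many supply points as demand points
(`1[b ∈ Y∖X]` is decreasing and its complement-conjugate is `1[b ∈ X∖Y]`; two-colouring Harris `sum_mul_sdiff_le_sum_mul`).
[cite: KozmaNitzan2024, Questions 8–9 (§5.5 p. 36) (context); Harris 1960] -/
theorem card_demand_le_card_supply (ends : ι → Sym2 V) (E : Finset ι) (u b : V)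
    (𝒱 : Finset ι → Prop) (hV : ∀ ⦃s t : Finset ι⦄, s ⊆ t → 𝒱 s → 𝒱 t) (L : ℝ) (hL : 0 ≤ L) :
    (∑ ω ∈ E.powerset, if 𝒱 ω ∧ b ∈ openCluster (ends '' (↑(E \ ω) : Set ι)) u ∧ b ∉ openCluster (ends '' (↑ω : Set ι)) u then L else 0)
    ≤ ∑ ω ∈ E.powerset, if 𝒱 ω ∧ b ∈ openCluster (ends '' (↑ω : Set ι)) u ∧ b ∉ openCluster (ends '' (↑(E \ ω) : Set ι)) u then L else 0 := by
  set C : Finset ι → Set V := fun ω => openCluster (ends '' (↑ω : Set ι)) u with hC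
  change (∑ ω ∈ E.powerset, if 𝒱 ω ∧ b ∈ C (E \ ω) ∧ b ∉ C ω then L else 0) ≤ ∑ ω ∈ E.powerset, if 𝒱 ω ∧ b ∈ C ω ∧ b ∉ C (E \ ω) then L else 0
  have hCmono : ∀ {ω ω' : Finset ι}, ω ⊆ ω' → C ω ⊆ C ω' := fun hle => openCluster_image_mono ends hle u
  set F : Finset ι → ℝ := fun ω => if 𝒱 ω then 1 else 0 with hF
  set G : Finset ι → ℝ := fun ω => if b ∈ C ω ∧ b ∉ C (E \ ω) then L else 0 with hG
  have mF : Monotone F := by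
    intro x y hxy
    simp only [hF]
    by_cases hx : 𝒱 x
    · rw [if_pos hx, if_pos (hV hxy hx)]
    · rw [if_neg hx]
      by_cases hy : 𝒱 y
      · rw [if_pos hy]; exact zero_le_one
      · rw [if_neg hy]
  have mG : Monotone G := by
    intro x y hxy
    simp only [hG]
    have hdiff : C (E \ y) ⊆ C (E \ x) := hCmono (Finset.sdiff_subset_sdiff (le_refl E) hxy)
    by_cases hx : b ∈ C x ∧ b ∉ C (E \ x)
    · have hy : b ∈ C y ∧ b ∉ C (E \ y) := ⟨hCmono hxy hx.1, fun hb' => hx.2 (hdiff hb')⟩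
      rw [if_pos hx, if_pos hy]
    · rw [if_neg hx]
      by_cases hy : b ∈ C y ∧ b ∉ C (E \ y)
      · rw [if_pos hy]; exact hL
      · rw [if_neg hy]
  have key := sum_mul_sdiff_le_sum_mul E F G mF mG
  have lhs : ∑ ω ∈ E.powerset, F ω * G (E \ ω) = ∑ ω ∈ E.powerset, (if 𝒱 ω ∧ b ∈ C (E \ ω) ∧ b ∉ C ω then L else 0) := by
    refine Finset.sum_congr rfl fun ω hω => ?_
    have hωE := Finset.mem_powerset.mp hω
    simp only [hF, hG]
    rw [Finset.sdiff_sdiff_eq_self hωE]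
    by_cases hv : 𝒱 ω
    · by_cases hc : b ∈ C (E \ ω) ∧ b ∉ C ω
      · rw [if_pos hv, if_pos hc, if_pos ⟨hv, hc⟩, one_mul]
      · rw [if_pos hv, if_neg hc, if_neg (fun h' => hc h'.2), mul_zero]
    · rw [if_neg hv, zero_mul, if_neg (fun h' => hv h'.1)]
  have rhs : ∑ ω ∈ E.powerset, F ω * G ω = ∑ ω ∈ E.powerset, (if 𝒱 ω ∧ b ∈ C ω ∧ b ∉ C (E \ ω) then L else 0) := by
    refine Finset.sum_congr rfl fun ω _ => ?_
    simp only [hF, hG]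
    by_cases hv : 𝒱 ω
    · by_cases hc : b ∈ C ω ∧ b ∉ C (E \ ω)
      · rw [if_pos hv, if_pos hc, if_pos ⟨hv, hc⟩, one_mul]
      · rw [if_pos hv, if_neg hc, if_neg (fun h' => hc h'.2), mul_zero]
    · rw [if_neg hv, zero_mul, if_neg (fun h' => hv h'.1)]
  rw [lhs, rhs] at key
  exact key

open Classical in
/-- **IET when the supply clusters cover (every graph, every up-set).**  If for every supply point `ω'` (`b ∈ X(ω')∖Y(ω')`) and every colouring
`ω` both clusters `X(ω)`, `Y(ω)` are contained in `X(ω')`, then the increasing-event transfer inequality holds for every up-closed `𝒱` and all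
admissible levels.  Covers `K_{2,r} = Θ(2,…,2)`, `Θ(1,2,…,2)` and every graph whose non-terminal vertices are all common neighbours of `u` and `b`
(there `X(ω') = V` at every supply point). Proof in the module docstring. [cite: KozmaNitzan2024, Questions 8–9 (§5.5 p. 36) (context)] -/
theorem iet_of_supply_covers (ends : ι → Sym2 V) (E : Finset ι) (u b : V)
    (𝒱 : Finset ι → Prop) (hV : ∀ ⦃s t : Finset ι⦄, s ⊆ t → 𝒱 s → 𝒱 t)
    (h k ha hb ka kb : Set V → ℝ) (mh : Monotone h) (mk : Monotone k)
    (ha0 : ∀ X, 0 ≤ ha X) (hah : ∀ X, ha X ≤ h X) (hb0 : ∀ X, 0 ≤ hb X) (hbh : ∀ X, hb X ≤ h X)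
    (ka0 : ∀ X, 0 ≤ ka X) (kak : ∀ X, ka X ≤ k X) (kb0 : ∀ X, 0 ≤ kb X) (kbk : ∀ X, kb X ≤ k X)
    (hcov : ∀ ω' ∈ E.powerset, b ∈ openCluster (ends '' (↑ω' : Set ι)) u → b ∉ openCluster (ends '' (↑(E \ ω') : Set ι)) u →
      ∀ ω ∈ E.powerset, openCluster (ends '' (↑ω : Set ι)) u ⊆ openCluster (ends '' (↑ω' : Set ι)) u ∧
        openCluster (ends '' (↑(E \ ω) : Set ι)) u ⊆ openCluster (ends '' (↑ω' : Set ι)) u) :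
    0 ≤ (∑ ω ∈ E.powerset, if 𝒱 ω ∧ b ∈ openCluster (ends '' (↑ω : Set ι)) u ∧ b ∉ openCluster (ends '' (↑(E \ ω) : Set ι)) u then
          h (openCluster (ends '' (↑ω : Set ι)) u) * k (openCluster (ends '' (↑ω : Set ι)) u) else 0)
        + ∑ ω ∈ E.powerset, if 𝒱 ω ∧ b ∈ openCluster (ends '' (↑(E \ ω) : Set ι)) u ∧ b ∉ openCluster (ends '' (↑ω : Set ι)) u then
          (ha (openCluster (ends '' (↑ω : Set ι)) u) - hb (openCluster (ends '' (↑(E \ ω) : Set ι)) u)) *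
            (ka (openCluster (ends '' (↑ω : Set ι)) u) - kb (openCluster (ends '' (↑(E \ ω) : Set ι)) u)) else 0 := by
  set C : Finset ι → Set V := fun ω => openCluster (ends '' (↑ω : Set ι)) u with hC
  change ∀ ω' ∈ E.powerset, b ∈ C ω' → b ∉ C (E \ ω') → ∀ ω ∈ E.powerset, C ω ⊆ C ω' ∧ C (E \ ω) ⊆ C ω' at hcov
  change 0 ≤ (∑ ω ∈ E.powerset, if 𝒱 ω ∧ b ∈ C ω ∧ b ∉ C (E \ ω) then h (C ω) * k (C ω) else 0)
      + ∑ ω ∈ E.powerset, if 𝒱 ω ∧ b ∈ C (E \ ω) ∧ b ∉ C ω then (ha (C ω) - hb (C (E \ ω))) * (ka (C ω) - kb (C (E \ ω))) else 0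
  -- the loss function of a demand point and its maximum over the demand points of 𝒱
  set loss : Finset ι → ℝ := fun ω => max (ha (C ω)) (hb (C (E \ ω))) * max (ka (C ω)) (kb (C (E \ ω))) with hloss
  have loss_nonneg : ∀ ω, 0 ≤ loss ω := fun ω =>
    mul_nonneg (le_trans (ha0 _) (le_max_left _ _)) (le_trans (ka0 _) (le_max_left _ _))
  have T_ge : ∀ ω, -loss ω ≤ (ha (C ω) - hb (C (E \ ω))) * (ka (C ω) - kb (C (E \ ω))) := by
    intro ω
    simp only [hloss]
    set a := ha (C ω); set p := hb (C (E \ ω)); set c := ka (C ω); set q := kb (C (E \ ω))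
    have ha' : 0 ≤ a := ha0 _
    have hp' : 0 ≤ p := hb0 _
    have hc' : 0 ≤ c := ka0 _
    have hq' : 0 ≤ q := kb0 _
    have h1 : |a - p| ≤ max a p := by
      rw [abs_le]; constructor
      · linarith [le_max_right a p]
      · linarith [le_max_left a p]
    have h2 : |c - q| ≤ max c q := by
      rw [abs_le]; constructor
      · linarith [le_max_right c q]
      · linarith [le_max_left c q]
    have h3 : |(a - p) * (c - q)| ≤ max a p * max c q := by
      rw [abs_mul]; exact mul_le_mul h1 h2 (abs_nonneg _) (le_trans ha' (le_max_left _ _))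
    linarith [neg_abs_le ((a - p) * (c - q)), h3]
  by_cases hD : ∃ ω ∈ E.powerset, 𝒱 ω ∧ b ∈ C (E \ ω) ∧ b ∉ C ω
  · -- a worst demand point
    obtain ⟨ω₀, hω₀, hmax⟩ := Finset.exists_max_image (E.powerset.filter fun ω => 𝒱 ω ∧ b ∈ C (E \ ω) ∧ b ∉ C ω) loss
      (by obtain ⟨ω, hω, hc⟩ := hD; exact ⟨ω, Finset.mem_filter.mpr ⟨hω, hc⟩⟩)
    set L := loss ω₀ with hLdef
    have hL : 0 ≤ L := loss_nonneg ω₀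
    have cnt := card_demand_le_card_supply ends E u b 𝒱 hV L hL
    change (∑ ω ∈ E.powerset, if 𝒱 ω ∧ b ∈ C (E \ ω) ∧ b ∉ C ω then L else 0)
      ≤ ∑ ω ∈ E.powerset, if 𝒱 ω ∧ b ∈ C ω ∧ b ∉ C (E \ ω) then L else 0 at cnt
    -- demand: T ≥ −L on 𝒱 ∩ D
    have hdem : ∀ ω ∈ E.powerset,
        -(if 𝒱 ω ∧ b ∈ C (E \ ω) ∧ b ∉ C ω then L else 0)
        ≤ (if 𝒱 ω ∧ b ∈ C (E \ ω) ∧ b ∉ C ω then (ha (C ω) - hb (C (E \ ω))) * (ka (C ω) - kb (C (E \ ω))) else 0) := by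
      intro ω hω
      by_cases hc : 𝒱 ω ∧ b ∈ C (E \ ω) ∧ b ∉ C ω
      · simp only [if_pos hc]
        have hle : loss ω ≤ L := hmax ω (Finset.mem_filter.mpr ⟨hω, hc⟩)
        linarith [T_ge ω]
      · simp only [if_neg hc]; linarith
    -- supply: hk(X') ≥ L on R-points (covering)
    have hω₀E : ω₀ ∈ E.powerset := (Finset.mem_filter.mp hω₀).1
    have hsup : ∀ ω ∈ E.powerset,
        (if 𝒱 ω ∧ b ∈ C ω ∧ b ∉ C (E \ ω) then L else 0) ≤ (if 𝒱 ω ∧ b ∈ C ω ∧ b ∉ C (E \ ω) then h (C ω) * k (C ω) else 0) := by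
      intro ω hω
      by_cases hc : 𝒱 ω ∧ b ∈ C ω ∧ b ∉ C (E \ ω)
      · simp only [if_pos hc]
        obtain ⟨hX, hY⟩ := hcov ω hω hc.2.1 hc.2.2 ω₀ hω₀E
        simp only [hLdef, hloss]
        have e1 : max (ha (C ω₀)) (hb (C (E \ ω₀))) ≤ h (C ω) :=
          max_le (le_trans (hah _) (mh hX)) (le_trans (hbh _) (mh hY))
        have e2 : max (ka (C ω₀)) (kb (C (E \ ω₀))) ≤ k (C ω) :=
          max_le (le_trans (kak _) (mk hX)) (le_trans (kbk _) (mk hY))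
        exact mul_le_mul e1 e2 (le_trans (ka0 _) (le_max_left _ _)) (le_trans (le_trans (ha0 _) (le_max_left _ _)) e1)
      · simp only [if_neg hc]; exact le_refl 0
    have s1 := Finset.sum_le_sum hdem
    have s2 := Finset.sum_le_sum hsup
    rw [Finset.sum_neg_distrib] at s1
    linarith
  · -- no demand point in 𝒱: the form is a sum of nonnegative supply terms
    have e0 : ∑ ω ∈ E.powerset, (if 𝒱 ω ∧ b ∈ C (E \ ω) ∧ b ∉ C ω then (ha (C ω) - hb (C (E \ ω))) * (ka (C ω) - kb (C (E \ ω))) else 0) = 0 := by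
      refine Finset.sum_eq_zero fun ω hω => ?_
      rw [if_neg]
      intro hc
      exact hD ⟨ω, hω, hc⟩
    rw [e0, add_zero]
    refine Finset.sum_nonneg fun ω _ => ?_
    by_cases hc : 𝒱 ω ∧ b ∈ C ω ∧ b ∉ C (E \ ω)
    · rw [if_pos hc]; exact mul_nonneg (le_trans (ha0 _) (hah _)) (le_trans (ka0 _) (kak _))
    · rw [if_neg hc]

end Coefficientwise

end Summit.CriticalPhenomena.PercolationContinuityZ3.Theorems
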